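import Mathlib.Analysis.Asymptotics.SuperpolynomialDecay
import Literature.Computability.Cryptography.CryptoFoundationsWave0
import Literature.Computability.Complexity.Randomized
import Literature.Computability.Complexity.Oracle
import Literature.Computability.Cryptography.OneWayFunctions
import Literature.Computability.Cryptography.Indistinguishability
import Literature.Computability.Cryptography.PseudorandomFunctions
import Literature.Computability.Cryptography.EncryptionSchemes
import Literature.Computability.Cryptography.CommitmentsSignatures
import HarnessLib

-- provenance: harness21/H21/H21/Statements/CryptoFoundations/Schemes.lean @ 2388ea9 (interim HEAD d8f2665); M5 mechanical rewrite
/-!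
# Crypto foundations: cryptographic schemes versus one-way functions (target statements)

Family `CryptoFoundations`, trunk `CryptoQuantFine` (G11), outline §3
(`CryptoFoundations/Schemes.lean`, item `CFSchemes`). The *definitions* of the schemes and of
the existence hypotheses live in the prelude:

* `Literature.Computability.Cryptography.OWFExist` (`OneWayFunctions.lean`, C2): strong one-way functions exist;
* `Literature.Computability.Cryptography.SecureSKEExist` (`EncryptionSchemes.lean`, C5): an efficient, correct
  private-key encryption scheme with indistinguishable *multiple* encryptions exists
  (messages may be longer than keys — the Impagliazzo–Luby hypothesis form);
* `Literature.Computability.Cryptography.BitCommitmentExist`, `Literature.Computability.Cryptography.SecureSignaturesExist`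
  (`CommitmentsSignatures.lean`, C6): non-interactive computationally hiding / statistically
  binding bit commitment exists; an EUF-CMA-secure signature scheme exists.

This file records the target statements carrying the inventory ids:

* **crypto-foundations.S13** (Impagliazzo–Luby, FOCS 1989, Thm. 1): each of secure private-key
  encryption and bit commitment implies one-way functions:
  `OWFExist_of_secureSKEExist`, `OWFExist_of_bitCommitmentExist`.
  Impagliazzo–Luby's Theorem 1 also lists *identification schemes* and (in the same paper)
  *secret key agreement*; both are interactive protocols and are **not formalised** in v0
  (see the module docstring of `Literature.Prelude.CryptoQuantFine.CommitmentsSignatures`).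
* **crypto-foundations.S23** (Rompel, STOC 1990; Goldreich 2004, Thm. 6.4.1): one-way functions
  imply EUF-CMA-secure signature schemes, `secureSignaturesExist_of_OWFExist`; the (folklore,
  Impagliazzo–Luby) converse `OWFExist_of_secureSignaturesExist`; and the packaged equivalence
  `secureSignaturesExist_iff_OWFExist`.

## Design choices

* No new definitions: every hypothesis is the prelude's `Prop` flag, so the statements are
  one-line implications between named propositions.
* Known theorems from the literature are `theorem … := by sorry` with citations; the
  equivalence S23 and the corollary `secureSignaturesExist_of_secureSKEExist` are assembled from
  them by real (one-line) proofs.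
* Mathlib has no one-way functions, encryption, commitment or signature schemes (grep for
  `OneWay`, `Encryption`, `Commitment`, `Signature` in Mathlib finds nothing relevant); the only
  Mathlib anchor is `Asymptotics.SuperpolynomialDecay` (negligible functions), used inside the
  prelude definitions.

## References

* R. Impagliazzo, M. Luby, *One-way functions are essential for complexity based cryptography*,
  FOCS 1989, Theorem 1 (and §3–§5).
* J. Rompel, *One-way functions are necessary and sufficient for secure signatures*, STOC 1990.
* M. Naor, M. Yung, *Universal one-way hash functions and their cryptographic applications*,
  STOC 1989.
* O. Goldreich, *Foundations of Cryptography II: Basic Applications*, CUP 2004, Def. 5.2.8,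
  Def. 6.1.2, Thm. 6.4.1; *Foundations of Cryptography I*, CUP 2001, Def. 2.2.1, §4.4.1.
-/

namespace Literature.Computability.Cryptography

open Filter Asymptotics _root_.Computability Complexity

/-! ### crypto-foundations.S13: secure schemes imply one-way functions (Impagliazzo–Luby) -/

/-- **crypto-foundations.S13** (private-key encryption ⇒ OWF). If there is an efficient,
correct private-key encryption scheme with indistinguishable multiple encryptions (in
particular one may securely encrypt messages longer than the key), then one-way functions
exist. Identification schemes and secret key agreement, also covered by Impagliazzo–Luby's
Theorem 1, are interactive protocols and are not formalised here.
[Impagliazzo–Luby 1989, Thm. 1; Goldreich 2004, §5.2 and Exercise 5.4] [cite: ImpagliazzoLuby1989, Thm. 1] -/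
def OWFExist_of_secureSKEExist : Prop :=
  SecureSKEExist → OWFExist

/-- **crypto-foundations.S13** (bit commitment ⇒ OWF). If there is an efficient, computationally
hiding, statistically binding (non-interactive) bit-commitment scheme, then one-way functions
exist. [Impagliazzo–Luby 1989, Thm. 1] [cite: ImpagliazzoLuby1989, Thm. 1] -/
def OWFExist_of_bitCommitmentExist : Prop :=
  BitCommitmentExist → OWFExist

/-! ### crypto-foundations.S23: one-way functions versus secure signatures (Rompel) -/

/-- **crypto-foundations.S23** (OWF ⇒ signatures). If one-way functions exist then there is an
EUF-CMA-secure (existentially unforgeable under adaptive chosen-message attack) signature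
scheme. The proof chain in print is: OWF ⇒ universal one-way hash functions (Rompel 1990)
⇒ one-time signatures + hash-and-sign + authentication trees (Naor–Yung 1989, Lamport 1979,
Merkle). [Rompel 1990; Goldreich 2004, Thm. 6.4.1] [cite: Rompel1990] -/
def secureSignaturesExist_of_OWFExist : Prop :=
  OWFExist → SecureSignaturesExist

/-- **crypto-foundations.S23** (signatures ⇒ OWF, the easy converse). If an EUF-CMA-secure
signature scheme exists then one-way functions exist (the map from key-generation coins to the
verification key is (distributionally) one-way). [Impagliazzo–Luby 1989, Thm. 1; Rompel 1990,
§1; Goldreich 2004, §6.4 introduction] [cite: ImpagliazzoLuby1989, Thm. 1] -/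
def OWFExist_of_secureSignaturesExist : Prop :=
  SecureSignaturesExist → OWFExist

/-- **crypto-foundations.S23** (equivalence). Secure signature schemes exist if and only if
one-way functions exist. [Rompel 1990 (title theorem); Goldreich 2004, Thm. 6.4.1] [cite: Rompel1990, (title theorem] -/
def secureSignaturesExist_iff_OWFExist : Prop :=
  SecureSignaturesExist ↔ OWFExist

/- interim proof relied on results that are now named facts (D-0014); demoted to a fact by the M5 import, proof preserved:
:=
  ⟨OWFExist_of_secureSignaturesExist, secureSignaturesExist_of_OWFExist⟩
-/

/-- Corollary of **crypto-foundations.S13** and **crypto-foundations.S23**: secure private-key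
encryption implies secure signatures (via one-way functions).
[Impagliazzo–Luby 1989, Thm. 1; Rompel 1990] [cite: ImpagliazzoLuby1989, Thm. 1] -/
def secureSignaturesExist_of_secureSKEExist : Prop :=
  SecureSKEExist → SecureSignaturesExist

/- interim proof relied on results that are now named facts (D-0014); demoted to a fact by the M5 import, proof preserved:
:=
  fun h => secureSignaturesExist_of_OWFExist (OWFExist_of_secureSKEExist h)
-/

/-- Corollary of **crypto-foundations.S13** and **crypto-foundations.S23**: bit commitment
implies secure signatures (via one-way functions). [Impagliazzo–Luby 1989, Thm. 1; Rompel 1990] [cite: ImpagliazzoLuby1989, Thm. 1] -/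
def secureSignaturesExist_of_bitCommitmentExist : Prop :=
  BitCommitmentExist → SecureSignaturesExist

/- interim proof relied on results that are now named facts (D-0014); demoted to a fact by the M5 import, proof preserved:
:=
  fun h => secureSignaturesExist_of_OWFExist (OWFExist_of_bitCommitmentExist h)
-/

end Literature.Computability.Cryptography
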